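import Summits.ResolutionOfSingularities.ResolutionOfSingularities.Theorems.WildConesCampaignW46SurfacesStatement
import Summits.ResolutionOfSingularities.ResolutionOfSingularities.Theorems.WildConesCampaignW46Surfaces
import Summits.ResolutionOfSingularities.ResolutionOfSingularities.Theorems.JacobianBudgetIsolatedJacobianDropBaseChange

/-!
# [OURS · L1 W4.6, rung (i) — PROOFS BY NAME] `CampaignW46SurfacesForcedExit p`, `…NoInfRun p`,
# `…ForcedOrder p`, `…MuDropLookahead p` for EVERY prime `p`, over EVERY field of characteristic `p`

Cell res-hironaka (LADDER-RESOLUTION rung L, D-0089), slot W4.6, seat res-L1-s46-pv-2 (rung (i) SURFACES, second prover;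
strategy: embedded surface in 3-space / route `WildCones`' point-blow-up dynamics, disjoint from res-L1-s46-pv-1's
Hauser–Wagner invariant). Host: route `WildCones`, crux `ClassicalRegimes` (stmt-ResolutionOfSingularities-16884),
`--supports … --as helper`.

HONEST FRAMING. Everything here is OURS; NOTHING is a statement of H. Hironaka's manuscript [Hironaka2017] and nothing of it
is used; no FACT-LIST premise. The statements are the predicates of `Theorems/WildConesCampaignW46SurfacesStatement.lean`;
the perfect-field theorems are `Theorems/WildConesCampaignW46Surfaces.lean` (p469938: Milnor descent through the crux's
stubs); this file REMOVES `[PerfectField κ]` by BASE CHANGE to an algebraic closure `κ̄` (perfect): route `JacobianBudget`'s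
landed kit (`JacobianBudget.BaseChange.finite_iff` / `finrank_eq`, `BaseChangeCalc.jac_comp` / `multP_iff` /
`step_comp` = the stub `stub_baseChange` of line `euler-noether`: `Isol`, `MultP`, `μ` invariant, `step` equivariant under
extension of the ground field; W4.1 bank item) plus the support-level invariance of `OrdP`/`OrdPSucc` and the equivariance of `run` proved
here. So the rung holds over EVERY field of characteristic `p` although the faithful geometric reading of the cleaning
step (a `z`-shift by `p`-th roots) lives over `κ̄`: the dynamics over `κ` is the restriction of the dynamics over `κ̄`, and
forcedness and `μ` do not see the difference. AI review is weaker than expert review.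

Main theorems (namespace `…Theorems`): `campaignW46SurfacesForcedExit (hp : p.Prime) : CampaignW46SurfacesForcedExit p`
(the rank-9 item of rung (i) can be registered with signature `CampaignW46SurfacesForcedExit p` for a fixed prime, or as
`∀ p, p.Prime → CampaignW46SurfacesForcedExit p` = `campaignW46SurfacesForcedExit_all`, and closed `--by` these),
`campaignW46SurfacesNoInfRun`, `campaignW46SurfacesForcedOrder`, `campaignW46SurfacesMuDropLookahead`.
-/

noncomputable section

-- single-problem summit: the doubled namespace component `ResolutionOfSingularities` is forced
set_option linter.dupNamespace false

open scoped BigOperators Classical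

namespace Summit.ResolutionOfSingularities.ResolutionOfSingularities.Theorems

namespace CampaignW46.Surfaces.BaseChange

open WildCones
open Summit.ResolutionOfSingularities.ResolutionOfSingularities.Theorems.JacobianBudget (BaseChange.finite_iff
  BaseChange.finrank_eq)
open Summit.ResolutionOfSingularities.ResolutionOfSingularities.Theorems.JacobianBudget.BaseChangeCalc
  (clean_comp step_comp jac_comp multP_iff)

variable {p n : ℕ} {κ L : Type} [Field κ] [Field L]

/-! ## Support-level invariants and the run under a homomorphism of fields -/

/-- `OrdP` only sees the support of the cleaned state, which a field homomorphism preserves. [folklore] -/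
theorem ordP_iff (φ : κ →+* L) (c : (Fin n → ℕ) → κ) :
    OrdP p n κ c ↔ OrdP p n L (fun A => φ (c A)) := by
  simp only [OrdP, clean_comp φ c, map_ne_zero_iff φ φ.injective]

/-- `OrdPSucc` likewise. [folklore] -/
theorem ordPSucc_iff (φ : κ →+* L) (c : (Fin n → ℕ) → κ) :
    OrdPSucc p n κ c ↔ OrdPSucc p n L (fun A => φ (c A)) := by
  simp only [OrdPSucc, clean_comp φ c, map_ne_zero_iff φ φ.injective]

/-- **The run commutes with a field homomorphism** (iterate `step_comp`). [folklore] -/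
theorem run_comp (φ : κ →+* L) (c₀ : (Fin n → ℕ) → κ) (i : ℕ → Fin n) (t : ℕ → Fin n → κ) (m : ℕ) :
    run p n L (fun A => φ (c₀ A)) i (fun k j => φ (t k j)) m = fun A => φ (run p n κ c₀ i t m A) := by
  induction m with
  | zero => rfl
  | succ m ih =>
    show step p n L (i m) (fun j => φ (t m j)) (run p n L (fun A => φ (c₀ A)) i (fun k j => φ (t k j)) m) =
      fun A => φ (step p n κ (i m) (t m) (run p n κ c₀ i t m) A)
    rw [ih, step_comp]

variable [Algebra κ L]

/-- Multiplicity `p` is invariant under extension of the ground field (the kit's `multP_iff`). [folklore] -/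
theorem multP_iff' (c : (Fin n → ℕ) → κ) :
    MultP p n κ c ↔ MultP p n L (fun A => algebraMap κ L (c A)) :=
  multP_iff (algebraMap κ L) c

/-- Forcedness (`Isol ∧ MultP`) is invariant under extension of the ground field (the kit: the Jacobian ideal of the
extended state is the extended Jacobian ideal, and finite colength is invariant). [folklore] -/
theorem forced_iff (c : (Fin n → ℕ) → κ) :
    (Isol p n κ c ∧ MultP p n κ c) ↔
      (Isol p n L (fun A => algebraMap κ L (c A)) ∧ MultP p n L (fun A => algebraMap κ L (c A))) :=
  and_congr (BaseChange.finite_iff (jac_comp (p := p) (algebraMap κ L) c)) (multP_iff (algebraMap κ L) c)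

/-- `μ` is invariant under extension of the ground field (the kit: colength is invariant). [folklore] -/
theorem mu_eq (c : (Fin n → ℕ) → κ) : mu p n κ c = mu p n L (fun A => algebraMap κ L (c A)) :=
  BaseChange.finrank_eq (jac_comp (p := p) (algebraMap κ L) c)

/-- One step commutes with extension of the ground field (the kit, function form). [folklore] -/
theorem step_eq (c : (Fin n → ℕ) → κ) (i : Fin n) (τ : Fin n → κ) :
    (fun A => algebraMap κ L (step p n κ i τ c A)) =
      step p n L i (fun j => algebraMap κ L (τ j)) (fun A => algebraMap κ L (c A)) :=
  (step_comp (algebraMap κ L) i τ c).symm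

end CampaignW46.Surfaces.BaseChange

/-! ## The four rung-(i) predicates, for every prime `p` -/

section Proofs

open WildCones CampaignW46.Surfaces CampaignW46.Surfaces.BaseChange

variable {p : ℕ}

/-- [OURS · L1 W4.6 rung (i); NOT a statement of the manuscript] **`CampaignW46SurfacesForcedOrder p` for every prime
`p`** — the forced surface regime lives in cleaned order exactly `p + 1`, over EVERY field of characteristic `p` (base
change to `κ̄` + `Surfaces.not_ordP_of_forcedSuccessor` / `ordPSucc_of_forcedSuccessor`). [folklore] -/
theorem campaignW46SurfacesForcedOrder (hp : p.Prime) : CampaignW46SurfacesForcedOrder p := by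
  intro κ _ _ c i τ hM hI' hM'
  let L := AlgebraicClosure κ
  haveI : CharP L p := charP_of_injective_algebraMap (algebraMap κ L).injective p
  have hML : MultP p 2 L (fun A => algebraMap κ L (c A)) := (multP_iff' (L := L) c).mp hM
  have hF' := (forced_iff (L := L) (step p 2 κ i τ c)).mp ⟨hI', hM'⟩
  rw [step_eq] at hF'
  refine ⟨fun hO => ?_, ?_⟩
  · exact not_ordP_of_forcedSuccessor hp _ i _ hML hF'.2 ((ordP_iff (algebraMap κ L) c).mp hO)
  · exact (ordPSucc_iff (algebraMap κ L) c).mpr (ordPSucc_of_forcedSuccessor hp _ i _ hML hF'.1 hF'.2)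

/-- [OURS · L1 W4.6 rung (i); NOT a statement of the manuscript] Consequence: over every field of characteristic `p`
(prime), a state of `z^p = a(u₁,u₂)` of multiplicity `p` with a forced successor has cleaned ORDER exactly `p + 1`, hence
`< 2p` — inside the Moh window of rung (iii). [folklore] -/
theorem campaignW46Surfaces_ord_clean_eq (hp : p.Prime) (κ : Type) [Field κ] [CharP κ p] (c : (Fin 2 → ℕ) → κ)
    (i : Fin 2) (τ : Fin 2 → κ) (hM : MultP p 2 κ c) (hI' : Isol p 2 κ (step p 2 κ i τ c))
    (hM' : MultP p 2 κ (step p 2 κ i τ c)) :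
    ord 2 κ (clean p 2 κ c) = p + 1 ∧ ord 2 κ (clean p 2 κ c) < 2 * p := by
  obtain ⟨hO, A, hA, hsum⟩ := campaignW46SurfacesForcedOrder hp κ c i τ hM hI' hM'
  have hord : ord 2 κ (clean p 2 κ c) = p + 1 := by
    unfold ord
    refine le_antisymm (Nat.sInf_le ⟨A, hA, hsum.symm⟩) (le_csInf ⟨_, A, hA, hsum.symm⟩ ?_)
    rintro m ⟨B, hB, rfl⟩
    have hge : p ≤ Finset.sum Finset.univ (fun j => B j) := hM.2 B hB
    have hne : Finset.sum Finset.univ (fun j => B j) ≠ p := fun h => hO ⟨B, hB, h⟩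
    omega
  have := hp.two_le
  exact ⟨hord, by omega⟩

/-- [OURS · L1 W4.6 rung (i); NOT a statement of the manuscript] **`CampaignW46SurfacesMuDropLookahead p` for every prime
`p`** — the one-step Milnor drop with look-ahead over EVERY field of characteristic `p` (base change: `μ` and forcedness
are invariant, `step` is equivariant; then `Surfaces.muDrop_of_forcedSuccessor₂` over `κ̄`). [folklore] -/
theorem campaignW46SurfacesMuDropLookahead (hp : p.Prime) : CampaignW46SurfacesMuDropLookahead p := by
  intro κ _ _ c i τ i' τ' hI hM hI' hM' hM''
  let L := AlgebraicClosure κ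
  haveI : CharP L p := charP_of_injective_algebraMap (algebraMap κ L).injective p
  have hF := (forced_iff (L := L) c).mp ⟨hI, hM⟩
  have hF' := (forced_iff (L := L) (step p 2 κ i τ c)).mp ⟨hI', hM'⟩
  have hM''L : MultP p 2 L (fun A => algebraMap κ L (step p 2 κ i' τ' (step p 2 κ i τ c) A)) :=
    (multP_iff' (L := L) _).mp hM''
  rw [step_eq, step_eq] at hM''L
  rw [step_eq] at hF'
  have key := muDrop_of_forcedSuccessor₂ hp _ i _ i' _ hF.1 hF.2 hF'.1 hF'.2 hM''L
  rw [mu_eq (L := L) c, mu_eq (L := L) (step p 2 κ i τ c), step_eq]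
  exact key

/-- [OURS · L1 W4.6 rung (i), replaces the ROLE of Th. 16.13 p.87 l.26–28 in this regime; NOT a statement of the
manuscript] **`CampaignW46SurfacesNoInfRun p` for every prime `p`** — no infinite forced run of `z^p = a(u₁,u₂)` over
ANY field of characteristic `p` (the run over `κ` is a run over `κ̄`; `Surfaces.not_infRun` there). [folklore] -/
theorem campaignW46SurfacesNoInfRun (hp : p.Prime) : CampaignW46SurfacesNoInfRun p := by
  intro κ _ _ c₀ i t hall
  let L := AlgebraicClosure κ
  haveI : CharP L p := charP_of_injective_algebraMap (algebraMap κ L).injective p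
  refine not_infRun hp (κ := L) (fun A => algebraMap κ L (c₀ A)) i (fun k j => algebraMap κ L (t k j)) fun m => ?_
  rw [run_comp]
  exact (forced_iff (L := L) _).mp (hall m)

/-- [OURS · L1 W4.6 rung (i), the campaign's «hence terminates» WITH A NUMBER; NOT a statement of the manuscript]
**`CampaignW46SurfacesForcedExit p` for every prime `p`** — over EVERY field of characteristic `p`, along every
chart/translation word some state of `z^p = a(u₁,u₂)` of index `≤ μ(c₀) + 1` is not forced
(`Surfaces.exists_exit_le_mu_succ` over `κ̄`, transported back: `μ(c₀)` and forcedness are invariant). [folklore] -/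
theorem campaignW46SurfacesForcedExit (hp : p.Prime) : CampaignW46SurfacesForcedExit p := by
  intro κ _ _ c₀ i t
  let L := AlgebraicClosure κ
  haveI : CharP L p := charP_of_injective_algebraMap (algebraMap κ L).injective p
  obtain ⟨m, hm, hnot⟩ :=
    exists_exit_le_mu_succ hp (κ := L) (fun A => algebraMap κ L (c₀ A)) i (fun k j => algebraMap κ L (t k j))
  refine ⟨m, ?_, fun hf => hnot ?_⟩
  · rw [mu_eq (L := L) c₀]
    exact hm
  · rw [run_comp]
    exact (forced_iff (L := L) _).mp hf

/-- [OURS · L1 W4.6 rung (i)] The rung statement for ALL primes at once (a single constant for the planner: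
`∀ p, p.Prime → CampaignW46SurfacesForcedExit p`). [folklore] -/
theorem campaignW46SurfacesForcedExit_all : ∀ p : ℕ, p.Prime → CampaignW46SurfacesForcedExit p :=
  fun _ hp => campaignW46SurfacesForcedExit hp

end Proofs

end Summit.ResolutionOfSingularities.ResolutionOfSingularities.Theorems

end
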